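import Summits.Ventures.PercRepro.FaceBridge
import Summits.Ventures.PercRepro.LemmaBPlusMask
import Summits.Ventures.PercRepro.C017Kernel

/-!
# Deciding Lemma B on a single big face from the packed row table

typer-1's `facesCheck` / `facesCheckM` decide Lemma B⁺ on EVERY face of a graph from one packed
row table — too slow beyond eight edges. Here the same machinery is used on ONE face: the integer
face slack `faceSlackZ` (`LemmaBPlusFaces.lean`) is `score − size` read from the row table
(`faceSlackZ_eq_table`), so a single face check `faceCheckM1` decided by the kernel gives
`0 ≤ faceSlackZ` on that face (`faceSlackZ_nonneg_of_faceCheckM1`), which is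
`badCount + liabilityCount ≤ goodCount` on the row map of the face (`faceSlackZ_cast`). The rows
of the face map are its partitions (`faceRow_eq_iff`), so `badCount` is `crossCount` and
`goodCount` is `topBotCount` (`crossCount_faceMap_eq_badCount`, `topBotCount_faceMap_eq_goodCount`):
**`faceMap_lemmaB_of_faceSlackZ_nonneg`**. For the full face `(⊤, ⊥)` the codes are `2^k − 1`
and `0` (`cfgOf_two_pow_sub_one`; typer-1's `cfgOf_zero` from `C017Kernel.lean`): `faceMap_lemmaB_full_of_check`.
-/

namespace PercRepro

open Finset

namespace MultiGraph

variable {V E : Type}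

/-- The row map of a face: the engine row of the face map. -/
noncomputable def faceRow (G : MultiGraph V E) (m : Fin 4 → V) (u v : Config E) :
    Config (Face u v) → Fin 15 :=
  fun ρ => row4 (G.faceMap m u v ρ)

/-- The row of a face point is `s` iff its face map is the kernel of the engine row `rgs4 s`. -/
theorem faceRow_eq_iff (G : MultiGraph V E) (m : Fin 4 → V) (u v : Config E)
    (ρ : Config (Face u v)) (s : Fin 15) :
    G.faceRow m u v ρ = s ↔ G.faceMap m u v ρ = Setoid.ker (rgs4 s) := by
  unfold faceRow faceMap
  rw [row4_markedPartition_eq_iff, partitionEvent_eq_partitionSetoidEvent]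
  rfl

/-- `cross4 0 = ab|cd` is the row `3`. -/
theorem cross4_zero_eq_ker : cross4 0 = Setoid.ker (rgs4 3) := rfl

/-- `cross4 1 = ac|bd` is the row `6`. -/
theorem cross4_one_eq_ker : cross4 1 = Setoid.ker (rgs4 6) := rfl

/-- `cross4 2 = ad|bc` is the row `8`. -/
theorem cross4_two_eq_ker : cross4 2 = Setoid.ker (rgs4 8) := rfl

/-- `⊤` is the row `0`. -/
theorem top_eq_ker_rgs4 : (⊤ : Setoid (Fin 4)) = Setoid.ker (rgs4 0) := Setoid.ker_rgs4_top.symm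

/-- `⊥` is the row `14`. -/
theorem bot_eq_ker_rgs4 : (⊥ : Setoid (Fin 4)) = Setoid.ker (rgs4 14) := Setoid.ker_rgs4_bot.symm

variable [Fintype E] [DecidableEq E]

/-- **`topBotCount` of a face map is `goodCount` of its row map.** -/
theorem topBotCount_faceMap_eq_goodCount (G : MultiGraph V E) (m : Fin 4 → V) (u v : Config E) :
    topBotCount (G.faceMap m u v) = goodCount (G.faceRow m u v) := by
  classical
  unfold topBotCount goodCount pairCount
  refine congrArg Finset.card (Finset.filter_congr fun ρ _ => ?_)
  rw [faceRow_eq_iff, faceRow_eq_iff, top_eq_ker_rgs4, bot_eq_ker_rgs4]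

/-- **`crossCount` of a face map is `badCount` of its row map.** -/
theorem crossCount_faceMap_eq_badCount (G : MultiGraph V E) (m : Fin 4 → V) (u v : Config E) :
    crossCount cross4 (G.faceMap m u v) = badCount (G.faceRow m u v) := by
  classical
  unfold crossCount badCount pairCount crossPairs4
  rw [Finset.sum_insert (by decide), Finset.sum_insert (by decide), Finset.sum_singleton]
  have h03 : ∀ ρ : Config (Face u v), G.faceMap m u v ρ = cross4 0 ↔ G.faceRow m u v ρ = 3 := by
    intro ρ
    rw [faceRow_eq_iff, cross4_zero_eq_ker]
  have h16 : ∀ ρ : Config (Face u v), G.faceMap m u v ρ = cross4 1 ↔ G.faceRow m u v ρ = 6 := by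
    intro ρ
    rw [faceRow_eq_iff, cross4_one_eq_ker]
  have h28 : ∀ ρ : Config (Face u v), G.faceMap m u v ρ = cross4 2 ↔ G.faceRow m u v ρ = 8 := by
    intro ρ
    rw [faceRow_eq_iff, cross4_two_eq_ker]
  have hsplit : (Finset.univ.filter fun ρ : Config (Face u v) =>
      ∃ i j : Fin 3, i < j ∧ G.faceMap m u v ρ = cross4 i ∧ G.faceMap m u v ρᶜ = cross4 j) =
      (Finset.univ.filter fun ρ => G.faceRow m u v ρ = 3 ∧ G.faceRow m u v ρᶜ = 6) ∪
        ((Finset.univ.filter fun ρ => G.faceRow m u v ρ = 3 ∧ G.faceRow m u v ρᶜ = 8) ∪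
          Finset.univ.filter fun ρ => G.faceRow m u v ρ = 6 ∧ G.faceRow m u v ρᶜ = 8) := by
    ext ρ
    simp only [Finset.mem_filter, Finset.mem_univ, true_and, Finset.mem_union]
    constructor
    · rintro ⟨i, j, hij, hi, hj⟩
      fin_cases i <;> fin_cases j <;> simp at hij
      · exact Or.inl ⟨(h03 ρ).1 hi, (h16 ρᶜ).1 hj⟩
      · exact Or.inr (Or.inl ⟨(h03 ρ).1 hi, (h28 ρᶜ).1 hj⟩)
      · exact Or.inr (Or.inr ⟨(h16 ρ).1 hi, (h28 ρᶜ).1 hj⟩)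
    · rintro (⟨h1, h2⟩ | ⟨h1, h2⟩ | ⟨h1, h2⟩)
      · exact ⟨0, 1, by decide, (h03 ρ).2 h1, (h16 ρᶜ).2 h2⟩
      · exact ⟨0, 2, by decide, (h03 ρ).2 h1, (h28 ρᶜ).2 h2⟩
      · exact ⟨1, 2, by decide, (h16 ρ).2 h1, (h28 ρᶜ).2 h2⟩
  rw [hsplit, Finset.card_union_of_disjoint, Finset.card_union_of_disjoint]
  · rw [Finset.disjoint_left]
    intro ρ h1 h2
    simp only [Finset.mem_filter, Finset.mem_univ, true_and] at h1 h2
    exact absurd (h1.1.symm.trans h2.1) (by decide)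
  · rw [Finset.disjoint_left]
    intro ρ h1 h2
    simp only [Finset.mem_filter, Finset.mem_union, Finset.mem_univ, true_and] at h1 h2
    rcases h2 with h2 | h2
    · exact absurd (h1.2.symm.trans h2.2) (by decide)
    · exact absurd (h1.1.symm.trans h2.1) (by decide)

variable [DecidableEq V] [Fintype V]

/-- **Lemma B on a face with nonnegative integer slack.** -/
theorem faceMap_lemmaB_of_faceSlackZ_nonneg (G : MultiGraph V E) (m : Fin 4 → V) {u v : Config E}
    (hvu : v ≤ u) (h : 0 ≤ G.faceSlackZ m u v) :
    crossCount cross4 (G.faceMap m u v) ≤ topBotCount (G.faceMap m u v) := by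
  have hc := G.faceSlackZ_cast m hvu
  have h' : (0 : ℝ) ≤ (G.faceSlackZ m u v : ℤ) := by exact_mod_cast h
  rw [hc] at h'
  have hl : (0 : ℝ) ≤ liabilityCount
      (fun ρ : Config (Face u v) => row4 (G.markedPartition (embed u v ρ) m)) := by
    exact_mod_cast Nat.zero_le _
  have key : (badCount (fun ρ : Config (Face u v) => row4 (G.markedPartition (embed u v ρ) m)) :
      ℝ) ≤ goodCount (fun ρ : Config (Face u v) => row4 (G.markedPartition (embed u v ρ) m)) := by
    linarith
  rw [crossCount_faceMap_eq_badCount, topBotCount_faceMap_eq_goodCount]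
  exact_mod_cast key

section Codes

variable {n k : ℕ}

/-- **The single-face kernel check**: the row table once, then the face `[V, U]` (codes) has
score ≥ size. -/
def faceCheckM1 (G : MultiGraph (Fin n) (Fin k)) (m : Fin 4 → Fin n) (U V : ℕ) : Bool :=
  withLitB (G.rowTableM m) fun T => decide (faceSizeM k U V ≤ faceScoreT k T U V)

/-- A single-face check gives nonnegative slack on that face. -/
theorem faceSlackZ_nonneg_of_faceCheckM1 (G : MultiGraph (Fin n) (Fin k))
    (m : Fin 4 → Fin n) {U V : ℕ} (hU : U < 2 ^ k) (hV : V < 2 ^ k)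
    (h : G.faceCheckM1 m U V = true) : 0 ≤ G.faceSlackZ m (cfgOf k U) (cfgOf k V) := by
  unfold faceCheckM1 at h
  rw [withLitB_eq, decide_eq_true_iff, G.rowTableM_eq] at h
  have := G.faceSlackZ_eq_table m ⟨U, hU⟩ ⟨V, hV⟩
  simp only at this
  rw [this]
  have : (faceSizeM k U V : ℤ) ≤ faceScoreT k (G.rowTable m) U V := by exact_mod_cast h
  linarith

/-- The code `2^k − 1` is the all-open configuration. -/
theorem cfgOf_two_pow_sub_one (k : ℕ) : cfgOf k (2 ^ k - 1) = ⊤ := by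
  funext e
  simp [cfgOf, Nat.testBit_two_pow_sub_one, e.isLt]

/-- **Lemma B on the full face from the kernel check of the code face `[0, 2^k − 1]`.** -/
theorem faceMap_lemmaB_full_of_check (G : MultiGraph (Fin n) (Fin k))
    (m : Fin 4 → Fin n) (h : G.faceCheckM1 m (2 ^ k - 1) 0 = true) :
    crossCount cross4 (G.faceMap m ⊤ ⊥) ≤ topBotCount (G.faceMap m ⊤ ⊥) := by
  have h0 := G.faceSlackZ_nonneg_of_faceCheckM1 m (U := 2 ^ k - 1) (V := 0)
    (Nat.sub_one_lt (by positivity)) (by positivity) h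
  rw [cfgOf_two_pow_sub_one, cfgOf_zero] at h0
  exact G.faceMap_lemmaB_of_faceSlackZ_nonneg m bot_le h0

/-- In a face with more than `card E − 1` free edges every edge is free (the statement of
`CrossFaces.lean`, repeated here to keep this file independent of it). -/
theorem free_of_card_face_gt' {E : Type} [Fintype E] {u v : Config E}
    (h : Fintype.card E - 1 < Fintype.card (Face u v)) (e : E) : v e = false ∧ u e = true := by
  by_contra hne
  have h1 := Fintype.card_subtype_lt (p := fun e : E => v e = false ∧ u e = true) hne
  have hc : Fintype.card (Face u v) = Fintype.card {x // v x = false ∧ u x = true} :=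
    Fintype.card_congr (Equiv.refl _)
  omega

/-- A face in which every edge is free is the full face. -/
theorem eq_top_bot_of_free {E : Type} {u v : Config E}
    (hfree : ∀ e, v e = false ∧ u e = true) : u = ⊤ ∧ v = ⊥ :=
  ⟨funext fun e => (hfree e).2, funext fun e => (hfree e).1⟩

/-- **Lemma B on every face of a 9-edge graph from ONE kernel check** (the full face; every other
face has at most eight free edges and is covered by the 8-point code bound). -/
theorem faceMap_lemmaB_of_check_nine (G : MultiGraph (Fin n) (Fin 9)) (m : Fin 4 → Fin n)
    (h : G.faceCheckM1 m (2 ^ 9 - 1) 0 = true) (u v : Config (Fin 9)) :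
    crossCount cross4 (G.faceMap m u v) ≤ topBotCount (G.faceMap m u v) := by
  by_cases h8 : Fintype.card (Face u v) ≤ 8
  · exact G.faceMap_lemmaB_of_card_le_eight m u v h8
  · have hfree := free_of_card_face_gt' (u := u) (v := v) (by simp; omega)
    obtain ⟨rfl, rfl⟩ := eq_top_bot_of_free hfree
    exact G.faceMap_lemmaB_full_of_check m h

end Codes

end MultiGraph

end PercRepro
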